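import Mathlib
import Summits.Ventures.HodgeRepro2.Tier7.Line3.KappaDecay
import Summits.Ventures.HodgeRepro2.Tier7.Line3.DominantSideOfKappa

/-!
# Tier 7 — LINE 3 support: the archimedean fields of x1's `KappaData` from the place data of the adapted pair
(`Line3/KappaDataArch.lean`; t7-L1-p5, gen 2; continues `Line3/KappaPlaces.lean` / `KappaDecay.lean`)

x1 g2's `DominantSideOfKappa.KappaData` (p677612) displays the residual (a′) as fields; its ARCHIMEDEAN fields are
`one_le_κ₂ / one_le_κ₃ : ∀ γ, 1 ≤ reAt (hK w) (κ γ)`, `hT : … → w (κ γ − κ γ₀) ≤ Binf` at every infinite place other than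
`w₂, w₃`, and the decays `ha₂ / ha₃ : ‖a γ‖ ≤ C · reAt (hK w) (κ γ) ^ (−k/2)`, where `reAt hw x = embedding_of_isReal hw x`.
This file proves each of them for the GLOBAL invariant `κF : Orb → K` of a family of isometries `mat γ` of the adapted
form (`algebraMap K E (κF γ) = kappa σ d f (mat γ)`, cf. `KappaDescent`) from the DATUM OF THE PLACE alone — an extension
`ψ : E →+* ℂ` of `w.embedding` intertwining the involutions and the signature datum of the adapted pair at `w`
(`Sig11Data` at a rank-one place, `Sig20Data` at a definite place):
* `coe_reAt_eq`: `(reAt hw (κF γ) : ℂ) = ψ (kappa σ d f (mat γ))`;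
* `one_le_reAt_of_sig11` (the fields `one_le_κ₂`, `one_le_κ₃`), `reAt_mem_Icc_of_sig20`;
* `place_sub_le_one_of_sig20` (the field `hT` with `Binf = 1`, per definite place);
* `exists_archFactor_decay_of_sig11` (the fields `ha₂`, `ha₃`): an archimedean factor `a : Orb → ℂ` — the model's
  two-torus orbital integral (p1's row 677) at the pair `(γ′, h) ∈ SU(1,1)²` representing `ψ (mat γ)`
  (`KappaDecay.Sig11Data.exists_SU11_kappa`) — with `‖a γ‖ ≤ decayConst k j n · monomialNormSq k n · reAt hw (κF γ) ^ (−k/2)`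
  for every `k ≥ 2` and every `j, n, p, q`; the constant and the exponent `k/2` are p1's.

What stays in words: that the §0 data at the real places ARE `Sig11Data` / `Sig20Data` for the global adapted pair (the
printed signature), and that the model integral `a γ` IS the real archimedean factor of the real test function at `γ`
(the dictionary's analytic half: U1 / U3, the lead's map). Nothing about periods or (N).
Sorry-free; axioms: propext / Classical.choice / Quot.sound. §8(d): uses an L-value-free non-vanishing device: NO.
-/

namespace Summit.Ventures.HodgeRepro2.Tier7.Line3.KappaDataArch

open NumberField Matrix MeasureTheory Summit.Ventures.HodgeRepro2.T7SupportTwoTorusInvariant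
  Summit.Ventures.HodgeRepro2.Tier7.Line3.KappaNatural Summit.Ventures.HodgeRepro2.Tier7.Line3.KappaArchimedean
  Summit.Ventures.HodgeRepro2.Tier7.Line3.KappaPlaces Summit.Ventures.HodgeRepro2.Tier7.Line3.KappaDecay
  Summit.Ventures.HodgeRepro2.Tier7.Line3.DominantSideOfKappa
open Summit.Ventures.HodgeRepro2.T5SU11Unimodular (SU11)
open Summit.Ventures.HodgeRepro2.T5BergmanCoefficient (mat act)
open Summit.Ventures.HodgeRepro2.T5SU11Fibration (rot)
open Summit.Ventures.HodgeRepro2.T5BergmanMatrixCoeff (matrixCoeff)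
open Summit.Ventures.HodgeRepro2.T5HaarCircle (haarCircle)
open Summit.Ventures.HodgeRepro2.T5BergmanKTypeMatrix (decayConst)
open Summit.Ventures.HodgeRepro2.T5BergmanParseval (monomialNormSq)

variable {E K : Type*} [Field E] [Field K] [Algebra K E] (σ : E →+* E) (ψ : E →+* ℂ)
  (d : Fin 2 → E) (f : Fin 2 → Fin 2 → E) {Orb : Type*} (matO : Orb → Matrix (Fin 2) (Fin 2) E) (κF : Orb → K)
  {w : InfinitePlace K} (hw : w.IsReal)

/-- the real value of the global invariant at `w` is its image under the extension `ψ` of `w.embedding` -/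
theorem coe_reAt_eq (hφ : ∀ x, ψ (algebraMap K E x) = w.embedding x)
    (hκ : ∀ γ, algebraMap K E (κF γ) = kappa σ d f (matO γ)) (γ : Orb) :
    ((reAt hw (κF γ) : ℝ) : ℂ) = ψ (kappa σ d f (matO γ)) := by
  unfold reAt
  rw [InfinitePlace.embedding_of_isReal_apply, ← hφ, hκ]

/-- **the fields `one_le_κ₂` / `one_le_κ₃`**: `1 ≤ reAt hw (κF γ)` at a rank-one place -/
theorem one_le_reAt_of_sig11 (hψ : ∀ x, ψ (σ x) = (starRingEnd ℂ) (ψ x))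
    (hφ : ∀ x, ψ (algebraMap K E x) = w.embedding x) {r s : Fin 2 → ℝ} (hdr : ∀ i, ψ (d i) = (r i : ℂ))
    (D : Sig11Data r s (fun j i => ψ (f j i))) (hiso : ∀ γ, IsIsom σ d (matO γ))
    (hκ : ∀ γ, algebraMap K E (κF γ) = kappa σ d f (matO γ)) (γ : Orb) :
    1 ≤ reAt hw (κF γ) := by
  obtain ⟨t, ht1, ht⟩ := map_kappa_sig11 σ ψ d f hψ hdr D (hiso γ)
  have h := coe_reAt_eq σ ψ d f matO κF hw hφ hκ γ
  rw [ht] at h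
  have : reAt hw (κF γ) = t := by exact_mod_cast h
  rw [this]
  exact ht1

/-- the real value at a definite place lies in `[0, 1]` -/
theorem reAt_mem_Icc_of_sig20 (hψ : ∀ x, ψ (σ x) = (starRingEnd ℂ) (ψ x))
    (hφ : ∀ x, ψ (algebraMap K E x) = w.embedding x) {r s : Fin 2 → ℝ} (hdr : ∀ i, ψ (d i) = (r i : ℂ))
    (D : Sig20Data r s (fun j i => ψ (f j i))) (hiso : ∀ γ, IsIsom σ d (matO γ))
    (hκ : ∀ γ, algebraMap K E (κF γ) = kappa σ d f (matO γ)) (γ : Orb) :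
    reAt hw (κF γ) ∈ Set.Icc (0 : ℝ) 1 := by
  obtain ⟨t, ht01, ht⟩ := map_kappa_sig20 σ ψ d f hψ hdr D (hiso γ)
  have h := coe_reAt_eq σ ψ d f matO κF hw hφ hκ γ
  rw [ht] at h
  have : reAt hw (κF γ) = t := by exact_mod_cast h
  rw [this]
  exact ht01

/-- **the field `hT` with `Binf = 1`**: `|κF γ − κF γ₀|_w ≤ 1` at a definite place -/
theorem place_sub_le_one_of_sig20 (hψ : ∀ x, ψ (σ x) = (starRingEnd ℂ) (ψ x))
    (hφ : ∀ x, ψ (algebraMap K E x) = w.embedding x) {r s : Fin 2 → ℝ} (hdr : ∀ i, ψ (d i) = (r i : ℂ))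
    (D : Sig20Data r s (fun j i => ψ (f j i))) (hiso : ∀ γ, IsIsom σ d (matO γ))
    (hκ : ∀ γ, algebraMap K E (κF γ) = kappa σ d f (matO γ)) (γ γ₀ : Orb) :
    w (κF γ - κF γ₀) ≤ 1 := by
  have := infinitePlace_kappa_sub_le_one σ ψ d f w.embedding hψ hφ hdr D (hiso γ) (hiso γ₀) (κF γ) (κF γ₀)
    (hκ γ) (hκ γ₀)
  rwa [InfinitePlace.mk_embedding] at this

/-- the real part of the image of the global invariant is its real value at `w` -/
theorem re_map_kappa_eq (hφ : ∀ x, ψ (algebraMap K E x) = w.embedding x)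
    (hκ : ∀ γ, algebraMap K E (κF γ) = kappa σ d f (matO γ)) (γ : Orb) :
    (ψ (kappa σ d f (matO γ))).re = reAt hw (κF γ) := by
  rw [← coe_reAt_eq σ ψ d f matO κF hw hφ hκ γ, Complex.ofReal_re]

/-- **the fields `ha₂` / `ha₃`**: an archimedean factor — the model's two-torus orbital integral at the representing pair
of `ψ (matO γ)` — with p1's decay `≤ decayConst · monomialNormSq · reAt hw (κF γ) ^ (−k/2)` for every `k ≥ 2`, `j, n, p, q` -/
theorem exists_archFactor_decay_of_sig11 [MeasurableSpace Circle] [BorelSpace Circle]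
    (hψ : ∀ x, ψ (σ x) = (starRingEnd ℂ) (ψ x)) (hφ : ∀ x, ψ (algebraMap K E x) = w.embedding x)
    {r s : Fin 2 → ℝ} (hdr : ∀ i, ψ (d i) = (r i : ℂ)) (D : Sig11Data r s (fun j i => ψ (f j i)))
    (hiso : ∀ γ, IsIsom σ d (matO γ)) (hκ : ∀ γ, algebraMap K E (κF γ) = kappa σ d f (matO γ))
    (k j n : ℕ) (hk : 2 ≤ k) (p q : ℤ) :
    ∃ rep : Orb → SU11 × SU11, ∀ γ : Orb,
      ‖∫ u : Circle, ∫ v : Circle,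
          matrixCoeff k (act k (rep γ).2 (fun w => w ^ j)) (fun w => w ^ n)
            (rot u * (rep γ).1 * ((rep γ).2 * rot v * (rep γ).2⁻¹)) *
            ((u : ℂ) ^ p * (starRingEnd ℂ) ((v : ℂ) ^ q)) ∂haarCircle ∂haarCircle‖ ≤
        decayConst k j n * monomialNormSq k n * reAt hw (κF γ) ^ (-(k : ℝ) / 2) := by
  have hd : (fun i => ψ (d i)) = fun i => (r i : ℂ) := funext hdr
  have hisoC : ∀ γ, IsIsom (starRingEnd ℂ) (fun i => (r i : ℂ)) ((matO γ).map ψ) := by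
    intro γ
    have := isIsom_map σ (starRingEnd ℂ) ψ hψ d (hiso γ)
    rwa [hd] at this
  have hex : ∀ γ, ∃ c : ℂ, Complex.normSq c = 1 ∧ ∃ γ' h : SU11,
      mat γ' = P r * (c • (matO γ).map ψ) * Q r ∧
      ∀ (k j n : ℕ), 2 ≤ k → ∀ (p q : ℤ),
        ‖∫ u : Circle, ∫ v : Circle,
            matrixCoeff k (act k h (fun w => w ^ j)) (fun w => w ^ n) (rot u * γ' * (h * rot v * h⁻¹)) *
              ((u : ℂ) ^ p * (starRingEnd ℂ) ((v : ℂ) ^ q)) ∂haarCircle ∂haarCircle‖ ≤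
          decayConst k j n * monomialNormSq k n *
            (kappa (starRingEnd ℂ) (fun i => (r i : ℂ)) (fun j i => ψ (f j i)) ((matO γ).map ψ)).re ^
              (-(k : ℝ) / 2) :=
    fun γ => Sig11Data.torus_orbital_decay D (hisoC γ)
  choose c _ γ' h _ hdecay using hex
  refine ⟨fun γ => (γ' γ, h γ), fun γ => ?_⟩
  have hre : (kappa (starRingEnd ℂ) (fun i => (r i : ℂ)) (fun j i => ψ (f j i)) ((matO γ).map ψ)).re =
      reAt hw (κF γ) := by
    rw [← re_map_kappa_eq σ ψ d f matO κF hw hφ hκ γ, kappa_map σ (starRingEnd ℂ) ψ hψ d f (matO γ), hd]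
  have := hdecay γ k j n hk p q
  rw [hre] at this
  exact this

end Summit.Ventures.HodgeRepro2.Tier7.Line3.KappaDataArch
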